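import Summits.NavierStokesRegularity.NavierStokesRegularity.Theorems.QuietScarPocketDoorDefs

/-!
# QuietScarPocketDoorTraceOfLocal — door S31 «QuietScarPocketDoor», plate P3 = PFℓ:
# **`terminalTraceAnalyticOfLocal_holds : TerminalTraceAnalyticOfLocal`** (ns-s29-p2 g3; nsreg-p1 g25 plate order 09:22:14Z)

PFℓ (texts of record `QuietScarPocketDoorDefs`, = Sketch31 v2.1 363b5766493b6c28 SEALED): the LOCAL physical form of LEG F
(`TerminalSliceAnalyticity`: a classical solution bounded with bounded pressure on `(a,0) × B(x_c,4r)` has a real-analytic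
terminal curl trace on `B(x_c,r)`) implies the LIMIT form (`TerminalTraceAnalytic`: for a field classical off the apex with
the one-point bound and shell-bounded pressure, `OffApexClassical`, every top curl trace `Ω₀` in the sense of
`TopCurlTendsto` is real-analytic on `ℝ³∖{0}`).

PROOF (routine, as announced in the sketch's docstring): cover `ℝ³∖{0}` by the balls `B(y, ‖y‖/8)`, `y ≠ 0`.  On
`(−1,0) × B(y, ‖y‖/2)` the field is classical (`IsClassicalNSSolutionOnRegion.mono_of_isOpen`), `‖U_c‖ ≤ 2C/‖y‖`
(`‖x‖ > ‖y‖/2` there) and `|q| ≤ P(δ)` for `δ = min (‖y‖/2) (2/(3‖y‖))` (`δ ≤ ‖x‖ ≤ δ⁻¹` there); the local statement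
gives an analytic `Ω₀'` on `B(y, ‖y‖/8)` with `curl U_c(s,x) → Ω₀'(x)`; `TopCurlTendsto` gives `curl U_c(s,x) → Ω₀(x)` at
every `x ≠ 0`; limits along `𝓝[<] 0` are unique, so `Ω₀ = Ω₀'` near `y` and `Ω₀` is analytic at `y`.

WHAT THIS IS NOT: a bookkeeping implication between two texts of door S31; `TerminalSliceAnalyticity` itself is PF
(PF-a/PF-b/PF-c); nothing about door S31 itself, 0056 or NS regularity is proved here (0056 OPEN).
-/

noncomputable section

set_option linter.dupNamespace false

namespace Summit.NavierStokesRegularity.NavierStokesRegularity.Theorems.QuietScarPocketDoor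

open MeasureTheory Set Function Filter Topology TopologicalSpace Metric
open scoped RealInnerProductSpace InnerProductSpace NNReal ENNReal Topology
open Literature.Analysis Literature.Analysis.FluidPDE

/-- `TopCurlTendsto` at a point: the curls converge to the trace along `𝓝[<] 0` at every `x ≠ 0`. -/
theorem TopCurlTendsto.tendsto {Uc : ℝ → EuclideanSpace ℝ (Fin 3) → EuclideanSpace ℝ (Fin 3)}
    {Ω₀ : EuclideanSpace ℝ (Fin 3) → EuclideanSpace ℝ (Fin 3)} (h : TopCurlTendsto Uc Ω₀)
    {x : EuclideanSpace ℝ (Fin 3)} (hx : x ≠ 0) :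
    Tendsto (fun s => curl (Uc s) x) (𝓝[<] (0 : ℝ)) (𝓝 (Ω₀ x)) := by
  rw [Metric.tendsto_nhds]
  intro θ hθ
  obtain ⟨s₀, δ, hs₀, -, hδ, hst⟩ := h x hx (θ / 2) (half_pos hθ)
  filter_upwards [Ioo_mem_nhdsLT hs₀] with s hs
  rw [dist_eq_norm]
  exact (hst s hs x (mem_ball_self hδ)).trans_lt (half_lt_self hθ)

/-- **PFℓ · `TerminalTraceAnalyticOfLocal` holds** (local LEG F ⇒ limit-form LEG F, by covering `ℝ³∖{0}` with the
balls `B(y, ‖y‖/8)` and uniqueness of limits along `𝓝[<] 0`). -/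
theorem terminalTraceAnalyticOfLocal_holds : TerminalTraceAnalyticOfLocal := by
  intro hloc C Uc Ω₀ hoff htop y hy
  have hy0 : y ≠ 0 := hy
  have hny : 0 < ‖y‖ := norm_pos_iff.2 hy0
  obtain ⟨q, hcl, hone, hshell⟩ := hoff
  -- the ball `B(y, ‖y‖/2) = B(y, 4r)` stays off the apex, with `‖y‖/2 < ‖x‖ < 3‖y‖/2` there
  set r : ℝ := ‖y‖ / 8 with hr_def
  have hr : 0 < r := by positivity
  have h4r : 4 * r = ‖y‖ / 2 := by rw [hr_def]; ring
  have hball : ∀ x ∈ ball y (4 * r), ‖y‖ / 2 < ‖x‖ ∧ ‖x‖ < 3 * ‖y‖ / 2 := by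
    intro x hx
    rw [mem_ball, dist_eq_norm, h4r] at hx
    constructor
    · have h1 : ‖y‖ ≤ ‖x‖ + ‖x - y‖ := by
        calc ‖y‖ = ‖x - (x - y)‖ := by rw [sub_sub_cancel]
          _ ≤ ‖x‖ + ‖x - y‖ := norm_sub_le _ _
      linarith
    · have h1 : ‖x‖ ≤ ‖x - y‖ + ‖y‖ := by
        calc ‖x‖ = ‖(x - y) + y‖ := by rw [sub_add_cancel]
          _ ≤ ‖x - y‖ + ‖y‖ := norm_add_le _ _
      linarith
  have hball0 : ∀ x ∈ ball y (4 * r), x ≠ 0 := by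
    intro x hx h0
    have h := (hball x hx).1
    rw [h0, norm_zero] at h
    linarith
  have hsub : Ioo (-1 : ℝ) 0 ×ˢ ball y (4 * r) ⊆ Ioo (-1 : ℝ) 0 ×ˢ ({0}ᶜ : Set (EuclideanSpace ℝ (Fin 3))) :=
    prod_mono Subset.rfl fun x hx => hball0 x hx
  have hcl' : IsClassicalNSSolutionOnRegion (Ioo (-1 : ℝ) 0 ×ˢ ball y (4 * r)) 1 0 Uc q :=
    hcl.mono_of_isOpen hsub (isOpen_Ioo.prod isOpen_ball)
  -- the velocity bound `M = 2C/‖y‖`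
  have hC : 0 ≤ C := by
    have h := hone (-1 / 2) ⟨by norm_num, by norm_num⟩ y hy0
    have hden : 0 < ‖y‖ + Real.sqrt (-(-1 / 2 : ℝ)) := by positivity
    by_contra hC
    have h2 : C / (‖y‖ + Real.sqrt (-(-1 / 2 : ℝ))) < 0 := div_neg_of_neg_of_pos (not_le.1 hC) hden
    linarith [norm_nonneg (Uc (-1 / 2) y)]
  set M : ℝ := C / (‖y‖ / 2) with hM_def
  have hM : 0 ≤ M := by positivity
  have hUM : ∀ t ∈ Ioo (-1 : ℝ) 0, ∀ x ∈ ball y (4 * r), ‖Uc t x‖ ≤ M := by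
    intro t ht x hx
    refine (hone t ht x (hball0 x hx)).trans ?_
    rw [hM_def]
    have h1 : ‖y‖ / 2 ≤ ‖x‖ + Real.sqrt (-t) := by linarith [(hball x hx).1, Real.sqrt_nonneg (-t)]
    exact div_le_div_of_nonneg_left hC (by positivity) h1
  -- the pressure bound on the shell `δ ≤ ‖x‖ ≤ δ⁻¹`
  set δ : ℝ := min (‖y‖ / 2) (2 / (3 * ‖y‖)) with hδ_def
  have hδ : 0 < δ := lt_min (by positivity) (by positivity)
  obtain ⟨P, hPq⟩ := hshell δ hδ
  set P' : ℝ := max P 0 with hP'_def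
  have hP' : 0 ≤ P' := le_max_right _ _
  have hqP : ∀ t ∈ Ioo (-1 : ℝ) 0, ∀ x ∈ ball y (4 * r), |q t x| ≤ P' := by
    intro t ht x hx
    obtain ⟨hx1, hx2⟩ := hball x hx
    refine (hPq t ht x ((min_le_left _ _).trans hx1.le) ?_).trans (le_max_left _ _)
    have hδ2 : δ ≤ 2 / (3 * ‖y‖) := min_le_right _ _
    have h3 : 3 * ‖y‖ / 2 ≤ δ⁻¹ := by
      rw [le_inv_comm₀ (by positivity) hδ]
      calc δ ≤ 2 / (3 * ‖y‖) := hδ2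
        _ = (3 * ‖y‖ / 2)⁻¹ := by rw [inv_div]
    exact hx2.le.trans h3
  -- the local analytic trace on `B(y, r)`
  obtain ⟨Ω₁, hΩ₁, hconv⟩ := hloc y r (-1) M P' hr (by norm_num) hM hP' Uc q hcl' hUM hqP
  -- identification with `Ω₀` near `y`
  have heq : ∀ x ∈ ball y r, Ω₀ x = Ω₁ x := by
    intro x hx
    have hx0 : x ≠ 0 := hball0 x (ball_subset_ball (by linarith) hx)
    exact tendsto_nhds_unique (htop.tendsto hx0) (hconv x hx)
  have hev : Ω₁ =ᶠ[𝓝 y] Ω₀ :=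
    Filter.eventuallyEq_iff_exists_mem.2 ⟨ball y r, ball_mem_nhds y hr, fun x hx => (heq x hx).symm⟩
  exact (hΩ₁ y (mem_ball_self hr)).congr hev

end Summit.NavierStokesRegularity.NavierStokesRegularity.Theorems.QuietScarPocketDoor

end
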